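import Mathlib
import Summits.QuantumFields.YangMills.Theses.FemtoCutoffLadder
import Summits.QuantumFields.YangMills.Theorems.FemtoCutoffLadderSmallFieldSplitGlueRepaired
import Summits.QuantumFields.YangMills.Theorems.FemtoCutoffLadderLargeFieldInsensitivityTopPos

/-!
# SKELETON «split-r» v2 for the crux `OctaveStepDecay` (stmt-QuantumFields-24153, route `FemtoCutoffLadder` rev 17; rung R2b1 = RECORD label)

Lead seat `ym-line-fcl-p1` g9 (2026-08-28).  The skeleton OF RECORD for 24153 after the planner's rev-12 split (ym-idea-1 g4, LINE 2
«restrict-then-tighten on the field space») and the lead's repair of its large-field half (g8, evidence `MISSTATED-25696.md` on 25696):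

* `stub_smallFieldOctaveStep : SmallFieldOctaveStep` — the route child A (stmt-QuantumFields-25695) BY NAME: the one-tower octave step for
  the SF_κ-COMPRESSED min–max values (test functions vanishing at every configuration with a spatial plaquette deviation `2 − Re tr U_p > β^{κ−1}`),
  summable defect `CΛ²/L'^σ` + telescoping allowance `D(1/β' − 1/β)`.  HARDEST (XL): the two-cutoff wall in small-field costume
  (critic idea-crit-4 r12 P2: fine smallness ≠ block smallness).
* `stub_largeFieldInsensitivityR : LargeFieldInsensitivityR` — the route child B′ (stmt-QuantumFields-26197, planner g5 rev 17 = the lead-g8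
  repair of the misstated 25696) BY NAME: slack `exp(CΛ²/L^σ + A/β²)` (`A ≥ 0` existential) instead of `exp(CΛ²/L^σ)`: `|z_κ − z| ≤ CΛ²/L^σ + A/β²`.
  The filed power rate is not what large-field suppression gives (per-plaquette weight `e^{−cβ^κ}` with `β` only logarithmic in `L` along the
  window, `WindowCoupling.four_b0_log_lt_beta_of_window` / `beta_le_of_window`); the `β`-small, `L`-uniform allowance `A/β²` is, and it is
  swallowed by the telescoping term at a matched octave pair (`WindowCoupling.sq_slack_le_telescoping`).  Clause 1 of B′ (`0 < t_κ`) is PROVED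
  unconditionally (`SFCompression.smallFieldTop_pos`, p607603) and the `L`-decaying term is idle on the proving side (`C = 0`), so the honest
  target behind the stub is B‴ = the two comparisons at slack `e^{A/β²}` (∀κ ∃A): `largeFieldInsensitivityR_of_betaAllowance` /
  `…_of_comparisons` (lead g9, `Theorems/FemtoCutoffLadderLargeFieldInsensitivityRReductions.lean`, p611095) give the stub from B‴ / B″.
  v1 of this skeleton (06:35Z) registered B″ as a local def; v2 registers the route child by name now that rev 17 has it.
Composition (kernel-checked): `OctaveStepDecay_of` = `octaveStepDecay_of_smallField_of_largeFieldR` (p606919, `…SmallFieldSplitGlueRepaired`;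
by-name form `octaveStepDecay_of_smallField_of_largeFieldInsensitivityR`, p611095).  Output constants `C = C₁ + 2C₂`, `σ`, `D = D₁ + 3A/(2b₀ log 2)`, `lam0 = min`, tower base `L₀ˢ·2^{L₀ᴸ}`.
HONEST FRAMING: both stubs are OPEN two-cutoff statements behind `UVStabilityNonUniqueness`; R2b1 is a RECORD rung — not infinite volume,
not a mass gap, not Clay.  No summit is proved by this line.
-/

set_option autoImplicit false

noncomputable section

open Literature.MathematicalPhysics.QuantumFieldTheory hiding SU2
open Summit.QuantumFields.YangMills.Theorems.FemtoTransferGap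
open Summit.QuantumFields.YangMills.Theorems.FemtoCutoffLadder
open Summit.QuantumFields.YangMills.Theses.FemtoCutoffLadder

namespace Summit.QuantumFields.YangMills.Cruxes.OctaveStepDecay.SplitR

/-- stub A (HARDEST, XL): the route child `SmallFieldOctaveStep` (stmt-QuantumFields-25695) BY NAME. -/
theorem stub_smallFieldOctaveStep : SmallFieldOctaveStep := by
  sorry

/-- stub B′ (XL, «same wall, honest allowance» — critic idea-crit-4 06:01Z): the route child `LargeFieldInsensitivityR`
(stmt-QuantumFields-26197 = 25696 restated with the `A/β²` allowance) BY NAME.  Honest target behind it: the two comparisons at slack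
`e^{A/β²}` (B‴; `largeFieldInsensitivityR_of_betaAllowance`). -/
theorem stub_largeFieldInsensitivityR : LargeFieldInsensitivityR := by
  sorry

/-- Kernel-checked composition: A and B′ give the crux `OctaveStepDecay` BY NAME (repaired glue p606919; the route decl's body is its
second hypothesis verbatim). -/
theorem OctaveStepDecay_of (hA : SmallFieldOctaveStep) (hB : LargeFieldInsensitivityR) : OctaveStepDecay :=
  octaveStepDecay_of_smallField_of_largeFieldR hA hB

/-- ★ The crux BY NAME from exactly the two declared stubs. -/
theorem OctaveStepDecay_holds_of_stubs : OctaveStepDecay :=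
  OctaveStepDecay_of stub_smallFieldOctaveStep stub_largeFieldInsensitivityR

end Summit.QuantumFields.YangMills.Cruxes.OctaveStepDecay.SplitR

end
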